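import Summits.ResolutionOfSingularities.ResolutionOfSingularities.Theorems.HomologicalConductorNoZenoL1wCoreCloser
import Literature.AlgebraicGeometry.Resolution.Lipman1969ProperTransformHolds
import Literature.AlgebraicGeometry.Resolution.Lipman1969ContractedCurveHolds
import Literature.AlgebraicGeometry.Resolution.Lipman1969RegularBaseChangeHolds
import HarnessLib

/-!
# Crux `NoZenoR` (stmt-ResolutionOfSingularities-19943), slot 5 (B1) closer — UNCONDITIONAL IN THE §15 FACTS (rank-9 cleanup)

OURS (cell res-hironaka, crux chain W4.4; prover res-inputs-p-6, D-0154 (2) inputs phase, rank-9 dead-binder cleanup of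
INPUTS-v0 §TOP-10 item 9 / CRIT-PASS-v1 R5 / W4.4 desk census `F53-CONSUMER-CENSUS-v0.md` §5); nothing here is a statement of the
manuscript under review (Hironaka 2017); AI-written, weaker than expert review.  SUPPORT-level, counted 0.  Def-free, fact-binders only.

The closer `stub_L1wCoreF3_of_facts` (file `HomologicalConductorNoZenoL1wCoreCloser.lean`) takes the fifteen-conjunct facts text of the
registered slot `Sig.FactsW3`.  Two of its conjuncts are now THEOREMS of the tree:
`Literature.AlgebraicGeometry.Resolution.Lipman1969_15_a_holds` (p606421, Lipman 1969 Prop. (15.1) a)) and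
`Literature.AlgebraicGeometry.Resolution.Lipman1969_15_b_holds` (p606000, Lipman 1969 Prop. (15.1) b)).  This sibling file records the same
conclusion under the THIRTEEN remaining printed facts (the W4.4 desk's weaken-only V35b text
`Sig.FactsW4 = Sig.FactsW2 ∧ (Lipman1969_13_1_b_rat ∧ Lipman1969_13_1_d_rat)`, unfolded), by feeding the two theorems to the closer
(`stub_L1wCoreF3_of_facts13`); under the TWELVE-conjunct text that also drops `Lipman1969_16_1_ii` (THEOREM `Lipman1969_16_1_ii_holds`,
p611393, Lipman 1969 Lemma (16.1)(ii); desk DESK WORD 60 count 12 with conjunct 6 general) (`stub_L1wCoreF3_of_facts12`); and — brick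
form — under the NINE fact binders of the closer's own signature that remain (`l1wCore_of_printedFacts9`).
No accepted file is edited; the statement of every named fact is unchanged; nothing becomes unconditional beyond the three fed inputs.
Resolution of singularities in dimension ≥ 4 / characteristic p is NOT proved by anything here.
-/

noncomputable section

-- single-problem summit: the doubled namespace component `ResolutionOfSingularities` is forced
set_option linter.dupNamespace false

open IsLocalRing
open Literature.AlgebraicGeometry Literature.AlgebraicGeometry.Resolution
open Summit.ResolutionOfSingularities.ResolutionOfSingularities.Theorems.NoZeno.Birth (nrm)
open Summit.ResolutionOfSingularities.ResolutionOfSingularities.Theorems.NoZeno.SandwichCluster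
open Summit.ResolutionOfSingularities.ResolutionOfSingularities.Theorems.NoZeno.SandwichCluster.Parasite
  (locPrime isLocalRing_locPrime)

namespace Summit.ResolutionOfSingularities.ResolutionOfSingularities.Theorems.NoZeno.ExcCount

/-- **The closer `stub_L1wCoreF3_of_facts` with the two §15 facts DISCHARGED**: the thirteen-conjunct printed-fact text
(`Sig.FactsW2 ∧ (Lipman1969_13_1_b_rat ∧ Lipman1969_13_1_d_rat)` unfolded — the W4.4 desk's weaken-only V35b slot text `Sig.FactsW4`)
implies the `Sig.L1Core` ∀-text verbatim.  Proof: the fifteen-conjunct closer fed with the theorems `Lipman1969_15_a_holds` (p606421) and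
`Lipman1969_15_b_holds` (p606000).
[cite: Lipman1969, Proposition (15.1) a), b); Theorem (4.1) (p. 204), Proposition (16.1)(ii), Corollary (27.3) (p. 277)] -/
theorem stub_L1wCoreF3_of_facts13
    (hF4 : (((CossartJannsenSaito2020General.{0} ∧ Lipman1969_1_2.{0} ∧ Lipman1969_4_1.{0} ∧ Lipman1969_12_1_i.{0} ∧
        Lipman1969_12_1_ii.{0} ∧ Literature.AlgebraicGeometry.Morphisms.GortzWedhorn2023_24_44_H2.{0}) ∧
      (Lipman1969_16_1_ii.{0} ∧ Lipman1969_16_5.{0} ∧ Lipman1969_27_1_reg_rat.{0} ∧ Lipman1969_27_3_rat.{0})) ∧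
      Literature.RingTheory.CohomologyAnnihilator.jacobianFloorNN_normal_dim3.{0}) ∧
      (Lipman1969_13_1_b_rat.{0} ∧ Lipman1969_13_1_d_rat.{0})) :
    ∀ (k K : Type) [Field k] [Field K] [Algebra k K] (T : Subalgebra k K) (P : Ideal ↥T) (hP : P.IsPrime),
    Algebra.EssFiniteType k ↥T → IsIntegrallyClosed ↥T → IsFractionRing ↥T K →
    ringKrullDim ↥(locPrime T P hP) = 2 →
    HasRationalSingularity ↥(locPrime T P hP) →
    ∀ (N : ℕ), @HasSplitExcCurveCountLE ↥(locPrime T P hP) _ (isLocalRing_locPrime T P hP) N →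
    ∀ (C : Set K), C ⊆ (T : Set K) →
      (Ideal.span {d : ↥(locPrime T P hP) | (d : K) ∈ C}).radical =
        @maximalIdeal ↥(locPrime T P hP) _ (isLocalRing_locPrime T P hP) →
      @IsSepX1Sandwiched ↥(locPrime T P hP) _ (isLocalRing_locPrime T P hP)
        (Ideal.span {d : ↥(locPrime T P hP) | (d : K) ∈ C}) →
    ∀ (x : K), x ∈ C → x ≠ 0 →
    ∀ (B : Subalgebra k K),
      B = Algebra.adjoin k ((locPrime T P hP : Set K) ∪ {y : K | ∃ c ∈ C, y = c * x⁻¹}) →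
    ∀ (𝔮 : Ideal ↥(nrm B)) (h𝔮 : 𝔮.IsPrime) (D' : Subring K) (hD' : IsLocalRing ↥D'),
      locPrime (nrm B) 𝔮 h𝔮 = D' → (locPrime T P hP : Set K) ⊆ D' →
      ringKrullDim ↥D' = 2 → IsIntegrallyClosed ↥D' →
      IsRegularLocalRing ↥D' ∨ (HasRationalSingularity ↥D' ∧ @HasSplitExcCurveCountLE ↥D' _ hD' (N - 1)) :=
  stub_L1wCoreF3_of_facts ⟨hF4.1, hF4.2, Lipman1969_15_a_holds, Lipman1969_15_b_holds⟩

/-- **The closer with the §15 pair AND Lemma (16.1)(ii) DISCHARGED**: the twelve-conjunct printed-fact text (the W4.4 desk's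
V35b + F-83-drop text, DESK WORD 60: `((CJS ∧ 1_2 ∧ 4_1 ∧ 12_1_i ∧ 12_1_ii ∧ GW_24_44_H2) ∧ (16_5 ∧ 27_1_reg_rat ∧ 27_3_rat)) ∧
jacobianFloorNN_normal_dim3) ∧ (13_1_b_rat ∧ 13_1_d_rat)`, conjunct 6 still the GENERAL `GortzWedhorn2023_24_44_H2`) implies the
`Sig.L1Core` ∀-text verbatim.  Proof: the fifteen-conjunct closer fed with `Lipman1969_15_a_holds` (p606421), `Lipman1969_15_b_holds`
(p606000) and `Lipman1969_16_1_ii_holds` (p611393).  (Conjunct 6 is not used by the closer, so the same one line serves any in-place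
replacement of it.)
[cite: Lipman1969, Proposition (15.1) a), b), Lemma (16.1)(ii); Theorem (4.1) (p. 204), Corollary (27.3) (p. 277)] -/
theorem stub_L1wCoreF3_of_facts12
    (hF5 : (((CossartJannsenSaito2020General.{0} ∧ Lipman1969_1_2.{0} ∧ Lipman1969_4_1.{0} ∧ Lipman1969_12_1_i.{0} ∧
        Lipman1969_12_1_ii.{0} ∧ Literature.AlgebraicGeometry.Morphisms.GortzWedhorn2023_24_44_H2.{0}) ∧
      (Lipman1969_16_5.{0} ∧ Lipman1969_27_1_reg_rat.{0} ∧ Lipman1969_27_3_rat.{0})) ∧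
      Literature.RingTheory.CohomologyAnnihilator.jacobianFloorNN_normal_dim3.{0}) ∧
      (Lipman1969_13_1_b_rat.{0} ∧ Lipman1969_13_1_d_rat.{0})) :
    ∀ (k K : Type) [Field k] [Field K] [Algebra k K] (T : Subalgebra k K) (P : Ideal ↥T) (hP : P.IsPrime),
    Algebra.EssFiniteType k ↥T → IsIntegrallyClosed ↥T → IsFractionRing ↥T K →
    ringKrullDim ↥(locPrime T P hP) = 2 →
    HasRationalSingularity ↥(locPrime T P hP) →
    ∀ (N : ℕ), @HasSplitExcCurveCountLE ↥(locPrime T P hP) _ (isLocalRing_locPrime T P hP) N →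
    ∀ (C : Set K), C ⊆ (T : Set K) →
      (Ideal.span {d : ↥(locPrime T P hP) | (d : K) ∈ C}).radical =
        @maximalIdeal ↥(locPrime T P hP) _ (isLocalRing_locPrime T P hP) →
      @IsSepX1Sandwiched ↥(locPrime T P hP) _ (isLocalRing_locPrime T P hP)
        (Ideal.span {d : ↥(locPrime T P hP) | (d : K) ∈ C}) →
    ∀ (x : K), x ∈ C → x ≠ 0 →
    ∀ (B : Subalgebra k K),
      B = Algebra.adjoin k ((locPrime T P hP : Set K) ∪ {y : K | ∃ c ∈ C, y = c * x⁻¹}) →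
    ∀ (𝔮 : Ideal ↥(nrm B)) (h𝔮 : 𝔮.IsPrime) (D' : Subring K) (hD' : IsLocalRing ↥D'),
      locPrime (nrm B) 𝔮 h𝔮 = D' → (locPrime T P hP : Set K) ⊆ D' →
      ringKrullDim ↥D' = 2 → IsIntegrallyClosed ↥D' →
      IsRegularLocalRing ↥D' ∨ (HasRationalSingularity ↥D' ∧ @HasSplitExcCurveCountLE ↥D' _ hD' (N - 1)) :=
  stub_L1wCoreF3_of_facts
    ⟨⟨⟨hF5.1.1.1, Lipman1969_16_1_ii_holds, hF5.1.1.2⟩, hF5.1.2⟩, hF5.2, Lipman1969_15_a_holds, Lipman1969_15_b_holds⟩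

/-- **The `Sig.L1Core` ∀-text under the NINE printed facts the closer uses, as SEPARATE binders** (brick-rule form;
`Lipman1969_15_a` / `Lipman1969_15_b` / `Lipman1969_16_1_ii` no longer appear — they are supplied by the tree's theorems
`Lipman1969_15_a_holds` (p606421) / `Lipman1969_15_b_holds` (p606000) / `Lipman1969_16_1_ii_holds` (p611393)).  The conjuncts of
`Sig.FactsW2` the closer does not bind (`CossartJannsenSaito2020General`, `GortzWedhorn2023_24_44_H2`, `jacobianFloorNN_normal_dim3`)
are not bound here; `Lipman1969_12_1_ii` and `Lipman1969_27_1_reg_rat` are bound because the closer's signature carries them (it does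
not use them).  Any later weaken-only slot text of the W4.4 registry that keeps these nine conjuncts is served by one
`fun h => l1wCore_of_printedFacts9 …` line.
[cite: Lipman1969, Proposition (15.1) a), b), Lemma (16.1)(ii); Theorem (4.1) (p. 204), Corollary (27.3) (p. 277)] -/
theorem l1wCore_of_printedFacts9
    (h131b : Lipman1969_13_1_b_rat.{0}) (h131d : Lipman1969_13_1_d_rat.{0})
    (h12 : Lipman1969_1_2.{0}) (h41 : Lipman1969_4_1.{0}) (h121i : Lipman1969_12_1_i.{0})
    (h121ii : Lipman1969_12_1_ii.{0}) (h165 : Lipman1969_16_5.{0}) (h271 : Lipman1969_27_1_reg_rat.{0})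
    (h273 : Lipman1969_27_3_rat.{0}) :
    ∀ (k K : Type) [Field k] [Field K] [Algebra k K] (T : Subalgebra k K) (P : Ideal ↥T) (hP : P.IsPrime),
    Algebra.EssFiniteType k ↥T → IsIntegrallyClosed ↥T → IsFractionRing ↥T K →
    ringKrullDim ↥(locPrime T P hP) = 2 →
    HasRationalSingularity ↥(locPrime T P hP) →
    ∀ (N : ℕ), @HasSplitExcCurveCountLE ↥(locPrime T P hP) _ (isLocalRing_locPrime T P hP) N →
    ∀ (C : Set K), C ⊆ (T : Set K) →
      (Ideal.span {d : ↥(locPrime T P hP) | (d : K) ∈ C}).radical =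
        @maximalIdeal ↥(locPrime T P hP) _ (isLocalRing_locPrime T P hP) →
      @IsSepX1Sandwiched ↥(locPrime T P hP) _ (isLocalRing_locPrime T P hP)
        (Ideal.span {d : ↥(locPrime T P hP) | (d : K) ∈ C}) →
    ∀ (x : K), x ∈ C → x ≠ 0 →
    ∀ (B : Subalgebra k K),
      B = Algebra.adjoin k ((locPrime T P hP : Set K) ∪ {y : K | ∃ c ∈ C, y = c * x⁻¹}) →
    ∀ (𝔮 : Ideal ↥(nrm B)) (h𝔮 : 𝔮.IsPrime) (D' : Subring K) (hD' : IsLocalRing ↥D'),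
      locPrime (nrm B) 𝔮 h𝔮 = D' → (locPrime T P hP : Set K) ⊆ D' →
      ringKrullDim ↥D' = 2 → IsIntegrallyClosed ↥D' →
      IsRegularLocalRing ↥D' ∨ (HasRationalSingularity ↥D' ∧ @HasSplitExcCurveCountLE ↥D' _ hD' (N - 1)) :=
  l1wCore_of_facts h131b h131d Lipman1969_15_a_holds Lipman1969_15_b_holds h12 h41 h121i h121ii
    Lipman1969_16_1_ii_holds h165 h271 h273

end Summit.ResolutionOfSingularities.ResolutionOfSingularities.Theorems.NoZeno.ExcCount

end
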